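import Literature.NumberTheory.DiophantineApproximation.RhinViolaResidueForm
import HarnessLib

/-!
# The Rhin–Viola double contour integral `I_z^{(2)}(h,j,k,l,m)` in residue form

Topic `Literature/NumberTheory/DiophantineApproximation`. DEFINITION (`I2`) with proved API; no named facts.
Source: G. Rhin, C. Viola, *The permutation group method for the dilogarithm*, Ann. Sc. Norm. Super. Pisa
(5) 4 (2005) 389–437, (2.3):

  `I_z^{(2)}(h,j,k,l,m) = z^{−l−m} (1/2πi)∮_{|x−z|=σ} (1/2πi)∮_{|y−x/(x−z)|=ϱ} x^j(1−x)^h y^k(1−y)^l dx dy`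
      `/ (x(1−y)+yz)^{j+k−m+1}`,

together with Lemma 2.3 (`I_z^{(2)}(0,0,0,0,0) = (1/2πi)∮_{|x−z|=σ} dx/(z−x) = −1`) and (2.15)
(`I_z^{(2)}(0,0,k,0,0) = (1/2πi)∮ dx/(z−x)^{k+1} = 0` for `k > 0`). **Residue form.** The inner integral is
`RhinViola.innerRes z j k l m x = P(x/(x−z))/(z−x)^n`, `n = j+k−m+1`, `P = D^{(n−1)}(Y^k(1−Y)^l)`
(`RhinViolaResidueForm.lean`). As a function of `x` it has its only pole at `x = z`: writing
`x/(x−z) = 1 + z/(x−z)` and `Q(w) = P(1 + z w) = Σ_i q_i w^i`, one gets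
`x^j(1−x)^h · innerRes(x) = (−1)^n Σ_i q_i x^j(1−x)^h (x−z)^{−(i+n)}`, whose residue at `x = z` is
`(−1)^n Σ_i q_i · (D^{(i+n−1)}(X^j(1−X)^h))(z)` (Taylor expansion at `z`, Hasse derivatives). We take this as the
DEFINITION of the outer contour integral, so that `I_z^{(2)}` is an explicit polynomial expression in `z`
(and `0` when `n ≤ 0`, the integrand being then a polynomial in `y`), and verify Lemma 2.3's value `−1` and
(2.15) in this vocabulary.

## References

* G. Rhin, C. Viola, Ann. Sc. Norm. Super. Pisa Cl. Sci. (5) 4 (2005) 389–437, (2.3), Lemma 2.3, (2.15).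
  [RhinViola2005]
-/

noncomputable section

namespace Literature.NumberTheory.DiophantineApproximation

namespace RhinViola

open Finset Polynomial

/-- **`I_z^{(2)}(h, j, k, l, m)`** (Rhin–Viola (2.3)) in double-residue form: with `n = j+k−m+1 ≥ 1`,
`P = D^{(n−1)}(Y^k(1−Y)^l)`, `Q = P ∘ (1 + zW)` (so that `P(x/(x−z)) = Q(1/(x−z))`),
`I2 = z^{−l−m} · (−1)^n Σ_{i ≤ k+l} (coeff_i Q) · (D^{(i+n−1)}(X^j(1−X)^h))(z)`; and `I2 = 0` if `j + k < m`.
[cite: RhinViola2005, (2.3)] -/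
def I2 (z : ℝ) (h j k l m : ℕ) : ℝ :=
  if m ≤ j + k then
    z ^ (-((l : ℤ) + m)) * ((-1) ^ (j + k - m + 1) *
      ∑ i ∈ range (k + l + 1),
        ((hasseDeriv (j + k - m) ((X : ℝ[X]) ^ k * (1 - X) ^ l)).comp (1 + C z * X)).coeff i *
          (hasseDeriv (i + (j + k - m)) ((X : ℝ[X]) ^ j * (1 - X) ^ h)).eval z)
  else 0

/-- `I_z^{(2)}(h,j,k,l,m) = 0` when `j + k < m` (the integrand is a polynomial in `y`; Rhin–Viola, proof of
Lemma 2.2). [cite: RhinViola2005, Lemma 2.2] -/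
theorem I2_of_lt {z : ℝ} (h : ℕ) {j k l m : ℕ} (hm : j + k < m) : I2 z h j k l m = 0 := by
  rw [I2, if_neg (by omega)]

/-- **Rhin–Viola 2005, Lemma 2.3 (the coefficient of `Li₂`)**: `I_z^{(2)}(0,0,0,0,0) = (1/2πi)∮ dx/(z−x) = −1`.
[cite: RhinViola2005, Lemma 2.3] -/
theorem I2_zero (z : ℝ) : I2 z 0 0 0 0 0 = -1 := by
  rw [I2, if_pos (le_refl _)]
  simp

/-- **RV (2.15)**: `I_z^{(2)}(0,0,k,0,0) = (1/2πi)∮ dx/(z−x)^{k+1} = 0` for `k > 0` (here `P = D^{(k)} Y^k = 1`,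
`Q = 1`, and `D^{(k)} 1 = 0`). [cite: RhinViola2005, (2.15)] -/
theorem I2_zero_k (z : ℝ) {k : ℕ} (hk : 0 < k) : I2 z 0 0 k 0 0 = 0 := by
  rw [I2, if_pos (Nat.zero_le _)]
  have hP : hasseDeriv (0 + k - 0) ((X : ℝ[X]) ^ k * (1 - X) ^ 0) = 1 := by
    simp [X_pow_eq_monomial, hasseDeriv_monomial]
  rw [hP, one_comp]
  refine mul_eq_zero_of_right _ (mul_eq_zero_of_right _ (sum_eq_zero fun i hi => ?_))
  rcases Nat.eq_zero_or_pos i with rfl | hi0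
  · simp [hasseDeriv_apply_one k hk]
  · simp [coeff_one, hi0.ne']

end RhinViola

end Literature.NumberTheory.DiophantineApproximation

end
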